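import Summits.AtomisticToContinuum.BoseEinsteinCondensation.Theorems.BECCellInformationOneBodyEntropyBoundDenseCellIMS

/-!
# Crux `OneBodyEntropyBound` — line `registered`, lead's stub `stub_denseCellBound`, part 1b:
# the one-particle local energy bound

Support file (`--supports stmt-AtomisticToContinuum-13440`, lead c2). For a `δ`-near-minimiser `Ψ` of `E₀(n+1, L)`, a
`C¹` one-body partition `χ² + η² = 1` acting on particle `x₀` only, the Dirichlet bosonic floor (hypothesis) and the
insertion bound `E₀(n+1,L) ≤ E₀(n,L) + κ` (hypothesis) give

  `∫ 1_T(x₀) (|∇₀Ψ|² + Σ_{j≥1} v(|x₀−x_j|) |Ψ|²) ≤ δ + (κ + 3G) ∫ 1_B(x₀) |Ψ|²`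

whenever `χ = 1` on `T`, `χ = ∇χ = ∇η = 0` off `B` and `|∇χ|² + |∇η|² ≤ G` (`local_energy_bound`). Ingredients: the
pointwise IMS identity of part 1a, the floor for `ηΨ` (a non-symmetric `(n+1)`-body function), and the Dirichlet group
extraction `groundStateEnergy_mul_le_setLIntegral_group` for the `n` untouched particles of `χΨ`, whose slices are
admissible `n`-body Dirichlet states: `E₀(n)‖χΨ‖² + share₀(χΨ) ≤ 𝓔[χΨ]`; comparing with `E₀(n+1) ≤ E₀(n) + κ` and
cancelling `E₀(n+1) ≠ ⊤` leaves the share of particle `0` on `{χ = 1}` bounded by one-body quantities.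
-/

noncomputable section

namespace Summit.AtomisticToContinuum.BoseEinsteinCondensation.Cruxes.OneBodyEntropyBound.Birth

namespace DenseCell

open MeasureTheory Filter Topology
open scoped ENNReal NNReal
open Literature.MathematicalPhysics.QuantumManyBody.BoseGas

variable {n : ℕ} {L : ℝ}

/-! ### Splitting off particle `0`: kinetic energy and interaction -/

/-- `|∇Ψ|² = |∇₀Ψ|² + Σ_{i≥1}|∇ᵢΨ|²` (the rest is the `kineticOn` of the group `Fin.succ`). [folklore] -/
theorem kineticDensity_eq_partialGradSq_add_kineticOn (ψ : Config (n + 1) → ℂ) (X : Config (n + 1)) :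
    kineticDensity ψ X = partialGradSq 0 ψ X + kineticOn (Fin.succEmb n) ψ X := by
  unfold kineticDensity kineticOn partialGradSq
  rw [Fin.sum_univ_succ]
  rfl

/-- `Σ_{i<j} v_{ij} = Σ_{j≥1} v_{0j} + Σ_{1≤i<j} v_{ij}` (the rest is the `interactionOn` of the group `Fin.succ`).
[folklore] -/
theorem interaction_eq_cross_add_interactionOn (v : ℝ → ℝ≥0∞) (X : Config (n + 1)) :
    interaction v X = (∑ j : Fin n, v (dist (X 0) (X j.succ))) + interactionOn (Fin.succEmb n) v X := by
  unfold interactionOn interaction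
  simp only [Finset.sum_filter, Fin.sum_univ_succ, Fin.succ_pos, if_true, if_false, zero_add,
    Fin.not_lt_zero, Fin.succ_lt_succ_iff]
  rfl

/-! ### Energies and masses of the two localised pieces -/

/-- The masses of `χΨ` and `ηΨ` add up to `‖Ψ‖² = 1`. [folklore] -/
theorem mass_localize_add {χ η : Space → ℝ} (hχ : Continuous χ) (hχη : ∀ x, χ x ^ 2 + η x ^ 2 = 1)
    (Ψ : TrialState (n + 1) L) :
    (∫⁻ X, (‖(χ (X 0) : ℂ) * Ψ.ψ X‖₊ : ℝ≥0∞) ^ 2) +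
        ∫⁻ X, (‖(η (X 0) : ℂ) * Ψ.ψ X‖₊ : ℝ≥0∞) ^ 2 = 1 := by
  have hm : Measurable fun X : Config (n + 1) => (‖(χ (X 0) : ℂ) * Ψ.ψ X‖₊ : ℝ≥0∞) ^ 2 :=
    measurable_normSq ((Complex.continuous_ofReal.comp (hχ.comp (continuous_apply 0))).mul
      Ψ.contDiff.continuous)
  rw [← lintegral_add_left hm, ← Ψ.norm_eq]
  refine lintegral_congr fun X => ?_
  rw [ennnorm_real_mul_sq, ennnorm_real_mul_sq, ← add_mul, ← ENNReal.ofReal_add (sq_nonneg _) (sq_nonneg _),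
    hχη, ENNReal.ofReal_one, one_mul]

/-- Measurability of the energy density of a localised piece. [folklore] -/
theorem measurable_energyDensity_localize {v : ℝ → ℝ≥0∞} (hv : Measurable v) {χ : Space → ℝ}
    (hχ : ContDiff ℝ 1 χ) (Ψ : TrialState (n + 1) L) :
    Measurable fun X : Config (n + 1) =>
      kineticDensity (fun X : Config (n + 1) => (χ (X 0) : ℂ) * Ψ.ψ X) X +
        interaction v X * (‖(χ (X 0) : ℂ) * Ψ.ψ X‖₊ : ℝ≥0∞) ^ 2 :=
  (measurable_kineticDensity (contDiff_localize hχ Ψ.contDiff)).add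
    ((measurable_interaction hv).mul (measurable_normSq (contDiff_localize hχ Ψ.contDiff).continuous))

/-- **IMS for the energies**: `𝓔[χΨ] + 𝓔[ηΨ] = energy Ψ + ∫ IMS`. [folklore] -/
theorem energy_localize_add {v : ℝ → ℝ≥0∞} (hv : Measurable v) {χ η : Space → ℝ} (hχ : ContDiff ℝ 1 χ)
    (hη : ContDiff ℝ 1 η) (hχη : ∀ x, χ x ^ 2 + η x ^ 2 = 1) (Ψ : TrialState (n + 1) L) :
    (∫⁻ X, kineticDensity (fun X : Config (n + 1) => (χ (X 0) : ℂ) * Ψ.ψ X) X +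
        interaction v X * (‖(χ (X 0) : ℂ) * Ψ.ψ X‖₊ : ℝ≥0∞) ^ 2) +
      (∫⁻ X, kineticDensity (fun X : Config (n + 1) => (η (X 0) : ℂ) * Ψ.ψ X) X +
        interaction v X * (‖(η (X 0) : ℂ) * Ψ.ψ X‖₊ : ℝ≥0∞) ^ 2) =
      energy v Ψ + ∫⁻ X, ∑ i : Fin (n + 1), ∑ k : Fin 3, ENNReal.ofReal
        (((fderiv ℝ χ (X 0) ((Pi.single i (EuclideanSpace.single k (1 : ℝ)) : Config (n + 1)) 0)) ^ 2 +
          (fderiv ℝ η (X 0) ((Pi.single i (EuclideanSpace.single k (1 : ℝ)) : Config (n + 1)) 0)) ^ 2) *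
          ‖Ψ.ψ X‖ ^ 2) := by
  have hd : Differentiable ℝ Ψ.ψ := Ψ.contDiff.differentiable one_ne_zero
  have hdχ : Differentiable ℝ χ := hχ.differentiable one_ne_zero
  have hdη : Differentiable ℝ η := hη.differentiable one_ne_zero
  have hmE : Measurable fun X : Config (n + 1) =>
      kineticDensity Ψ.ψ X + interaction v X * (‖Ψ.ψ X‖₊ : ℝ≥0∞) ^ 2 :=
    (measurable_kineticDensity Ψ.contDiff).add
      ((measurable_interaction hv).mul (measurable_normSq Ψ.contDiff.continuous))
  rw [← lintegral_add_left (measurable_energyDensity_localize hv hχ Ψ), energy,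
    ← lintegral_add_left hmE]
  refine lintegral_congr fun X => ?_
  have hk := kineticDensity_localize_add hdχ hdη hχη hd X
  have hm : interaction v X * (‖(χ (X 0) : ℂ) * Ψ.ψ X‖₊ : ℝ≥0∞) ^ 2 +
      interaction v X * (‖(η (X 0) : ℂ) * Ψ.ψ X‖₊ : ℝ≥0∞) ^ 2 =
      interaction v X * (‖Ψ.ψ X‖₊ : ℝ≥0∞) ^ 2 := by
    rw [ennnorm_real_mul_sq, ennnorm_real_mul_sq, ← mul_add, ← add_mul,
      ← ENNReal.ofReal_add (sq_nonneg _) (sq_nonneg _), hχη, ENNReal.ofReal_one, one_mul]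
  calc _ = (kineticDensity (fun X : Config (n + 1) => (χ (X 0) : ℂ) * Ψ.ψ X) X +
        kineticDensity (fun X : Config (n + 1) => (η (X 0) : ℂ) * Ψ.ψ X) X) +
        (interaction v X * (‖(χ (X 0) : ℂ) * Ψ.ψ X‖₊ : ℝ≥0∞) ^ 2 +
          interaction v X * (‖(η (X 0) : ℂ) * Ψ.ψ X‖₊ : ℝ≥0∞) ^ 2) := by ring
    _ = _ := by rw [hk, hm]; ring

/-- **Group extraction for `χΨ`**: the `n` untouched particles of `χ(x₀)Ψ` carry at least `E₀(n, L)` times its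
mass (`groundStateEnergy_mul_le_setLIntegral_group` with the group `Fin.succ`). [cite: LSSY2005, (2.52)–(2.53)] -/
theorem groundStateEnergy_mul_mass_localize_le {v : ℝ → ℝ≥0∞} (hv : Measurable v) {χ : Space → ℝ}
    (hχ : ContDiff ℝ 1 χ) (Ψ : TrialState (n + 1) L) :
    groundStateEnergy v n L * ∫⁻ X, (‖(χ (X 0) : ℂ) * Ψ.ψ X‖₊ : ℝ≥0∞) ^ 2 ≤
      ∫⁻ X, kineticOn (Fin.succEmb n) (fun X : Config (n + 1) => (χ (X 0) : ℂ) * Ψ.ψ X) X +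
        interactionOn (Fin.succEmb n) v X * (‖(χ (X 0) : ℂ) * Ψ.ψ X‖₊ : ℝ≥0∞) ^ 2 := by
  set ι : Fin n ↪ Fin (n + 1) := Fin.succEmb n with hι
  have h0 : (0 : Fin (n + 1)) ∉ Set.range ι := by
    rintro ⟨i, hi⟩
    exact Fin.succ_ne_zero i hi
  have hsymm : ∀ (τ : Equiv.Perm (Fin n)) (X : Config (n + 1)),
      (fun X : Config (n + 1) => (χ (X 0) : ℂ) * Ψ.ψ X) (X ∘ (τ.extendDomain (Equiv.ofInjective ι ι.injective))) =
        (fun X : Config (n + 1) => (χ (X 0) : ℂ) * Ψ.ψ X) X := by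
    intro τ X
    simp only [Function.comp_apply]
    rw [Equiv.Perm.extendDomain_apply_not_subtype _ _ h0, Ψ.symm]
  have hsupp : ∀ X : Config (n + 1), (∃ i, X (ι i) - 0 ∉ box L) →
      (fun X : Config (n + 1) => (χ (X 0) : ℂ) * Ψ.ψ X) X = 0 := by
    rintro X ⟨i, hi⟩
    rw [sub_zero] at hi
    have : Ψ.ψ X = 0 := Ψ.eq_zero X fun hX => hi (hX (ι i))
    simp [this]
  have h := groundStateEnergy_mul_le_setLIntegral_group ι 0 L hv (contDiff_localize hχ Ψ.contDiff)
    hsymm hsupp Set.univ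
  simpa only [Set.mem_univ, Set.setOf_true, Measure.restrict_univ] using h

/-! ### The one-particle local energy bound -/

/-- On `{χ = 1}` the share of particle `0` in `χΨ` is that in `Ψ`. [folklore] -/
theorem indicator_share_le {v : ℝ → ℝ≥0∞} {χ η : Space → ℝ} (hχ : Differentiable ℝ χ)
    (hχη : ∀ x, χ x ^ 2 + η x ^ 2 = 1) {T : Set Space} (hT : ∀ x ∈ T, χ x = 1)
    (Ψ : TrialState (n + 1) L) (X : Config (n + 1)) :
    T.indicator (fun _ => (1 : ℝ≥0∞)) (X 0) *
        (partialGradSq 0 Ψ.ψ X + (∑ j : Fin n, v (dist (X 0) (X j.succ))) * (‖Ψ.ψ X‖₊ : ℝ≥0∞) ^ 2) ≤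
      partialGradSq 0 (fun X : Config (n + 1) => (χ (X 0) : ℂ) * Ψ.ψ X) X +
        (∑ j : Fin n, v (dist (X 0) (X j.succ))) * (‖(χ (X 0) : ℂ) * Ψ.ψ X‖₊ : ℝ≥0∞) ^ 2 := by
  by_cases hX : X 0 ∈ T
  · rw [Set.indicator_of_mem hX, one_mul]
    have h1 : χ (X 0) = 1 := hT _ hX
    have h0 : fderiv ℝ χ (X 0) = 0 := fderiv_eq_zero_of_eq_one hχη h1
    have hd : Differentiable ℝ Ψ.ψ := Ψ.contDiff.differentiable one_ne_zero
    have hp : partialGradSq 0 (fun X : Config (n + 1) => (χ (X 0) : ℂ) * Ψ.ψ X) X =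
        partialGradSq 0 Ψ.ψ X := by
      unfold partialGradSq
      refine Finset.sum_congr rfl fun k _ => ?_
      rw [fderiv_localize_apply hχ hd, h0, h1]
      simp
    rw [hp, h1]
    simp
  · rw [Set.indicator_of_notMem hX, zero_mul]
    exact zero_le

/-- The mass density of `χΨ` is at most `1_B(x₀)|Ψ|²` when `χ = 0` off `B` (and `|χ| ≤ 1`). [folklore] -/
theorem mass_localize_le_indicator {χ η : Space → ℝ} (hχη : ∀ x, χ x ^ 2 + η x ^ 2 = 1)
    {B : Set Space} (hB : ∀ x, x ∉ B → χ x = 0) (ψ : Config (n + 1) → ℂ) (X : Config (n + 1)) :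
    (‖(χ (X 0) : ℂ) * ψ X‖₊ : ℝ≥0∞) ^ 2 ≤
      B.indicator (fun _ => (1 : ℝ≥0∞)) (X 0) * (‖ψ X‖₊ : ℝ≥0∞) ^ 2 := by
  rw [ennnorm_real_mul_sq]
  by_cases hX : X 0 ∈ B
  · rw [Set.indicator_of_mem hX]
    have h1 : ENNReal.ofReal (χ (X 0) ^ 2) ≤ 1 := by
      rw [← ENNReal.ofReal_one]
      refine ENNReal.ofReal_le_ofReal ?_
      have := abs_le_one_of_partition hχη (X 0)
      nlinarith [abs_nonneg (χ (X 0)), sq_abs (χ (X 0))]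
    exact mul_le_mul' h1 le_rfl
  · rw [hB _ hX]
    simp

/-- **One-particle local energy bound (lead's stub `stub_denseCellBound`, part 1).** For a `δ`-near-minimiser
`Ψ` of `E₀(n+1,L) ≠ ⊤`, a `C¹` one-body partition `χ² + η² = 1` with `|∇χ|² + |∇η|² ≤ G`, `χ = ∇χ = ∇η = 0`
off `B` and `χ = 1` on `T`, the Dirichlet bosonic floor for `(n+1, L)` and the insertion bound
`E₀(n+1,L) ≤ E₀(n,L) + κ`:
`∫ 1_T(x₀)(|∇₀Ψ|² + Σ_{j≥1} v(|x₀−x_j|)|Ψ|²) ≤ δ + (κ + 3G) ∫ 1_B(x₀)|Ψ|²`. [folklore] -/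
theorem local_energy_bound {v : ℝ → ℝ≥0∞} (hv : Measurable v)
    (hfloor : ∀ f : Config (n + 1) → ℂ, ContDiff ℝ 1 f → (∀ X, X ∉ boxN (n + 1) L → f X = 0) →
      groundStateEnergy v (n + 1) L * ∫⁻ X, (‖f X‖₊ : ℝ≥0∞) ^ 2 ≤
        ∫⁻ X, kineticDensity f X + interaction v X * (‖f X‖₊ : ℝ≥0∞) ^ 2)
    {χ η : Space → ℝ} (hχ : ContDiff ℝ 1 χ) (hη : ContDiff ℝ 1 η) (hχη : ∀ x, χ x ^ 2 + η x ^ 2 = 1)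
    {G : ℝ} (hG : ∀ x, ‖fderiv ℝ χ x‖ ^ 2 + ‖fderiv ℝ η x‖ ^ 2 ≤ G)
    {B : Set Space} (hB : ∀ x, x ∉ B → χ x = 0 ∧ fderiv ℝ χ x = 0 ∧ fderiv ℝ η x = 0)
    {T : Set Space} (hT : ∀ x ∈ T, χ x = 1)
    {κ δ : ℝ≥0∞} (hEtop : groundStateEnergy v (n + 1) L ≠ ⊤)
    (hins : groundStateEnergy v (n + 1) L ≤ groundStateEnergy v n L + κ)
    (Ψ : TrialState (n + 1) L) (hΨ : energy v Ψ ≤ groundStateEnergy v (n + 1) L + δ) :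
    ∫⁻ X, T.indicator (fun _ => (1 : ℝ≥0∞)) (X 0) *
        (partialGradSq 0 Ψ.ψ X + (∑ j : Fin n, v (dist (X 0) (X j.succ))) * (‖Ψ.ψ X‖₊ : ℝ≥0∞) ^ 2) ≤
      δ + (κ + ENNReal.ofReal (3 * G)) *
        ∫⁻ X, B.indicator (fun _ => (1 : ℝ≥0∞)) (X 0) * (‖Ψ.ψ X‖₊ : ℝ≥0∞) ^ 2 := by
  have hd : Differentiable ℝ Ψ.ψ := Ψ.contDiff.differentiable one_ne_zero
  have hdχ : Differentiable ℝ χ := hχ.differentiable one_ne_zero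
  have hdη : Differentiable ℝ η := hη.differentiable one_ne_zero
  -- the two pieces and the cast of quantities
  set ψχ : Config (n + 1) → ℂ := fun X => (χ (X 0) : ℂ) * Ψ.ψ X with hψχ
  set ψη : Config (n + 1) → ℂ := fun X => (η (X 0) : ℂ) * Ψ.ψ X with hψη
  set E₁ := groundStateEnergy v (n + 1) L with hE₁
  set E₀' := groundStateEnergy v n L with hE₀'
  set mχ := ∫⁻ X, (‖ψχ X‖₊ : ℝ≥0∞) ^ 2 with hmχ
  set mη := ∫⁻ X, (‖ψη X‖₊ : ℝ≥0∞) ^ 2 with hmη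
  set Eχ := ∫⁻ X, kineticDensity ψχ X + interaction v X * (‖ψχ X‖₊ : ℝ≥0∞) ^ 2 with hEχ
  set Eη := ∫⁻ X, kineticDensity ψη X + interaction v X * (‖ψη X‖₊ : ℝ≥0∞) ^ 2 with hEη
  set IMS := ∫⁻ X, ∑ i : Fin (n + 1), ∑ k : Fin 3, ENNReal.ofReal
    (((fderiv ℝ χ (X 0) ((Pi.single i (EuclideanSpace.single k (1 : ℝ)) : Config (n + 1)) 0)) ^ 2 +
      (fderiv ℝ η (X 0) ((Pi.single i (EuclideanSpace.single k (1 : ℝ)) : Config (n + 1)) 0)) ^ 2) *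
      ‖Ψ.ψ X‖ ^ 2) with hIMS
  set Sh := ∫⁻ X, partialGradSq 0 ψχ X +
    (∑ j : Fin n, v (dist (X 0) (X j.succ))) * (‖ψχ X‖₊ : ℝ≥0∞) ^ 2 with hSh
  set Rest := ∫⁻ X, kineticOn (Fin.succEmb n) ψχ X +
    interactionOn (Fin.succEmb n) v X * (‖ψχ X‖₊ : ℝ≥0∞) ^ 2 with hRest
  set J := ∫⁻ X, B.indicator (fun _ => (1 : ℝ≥0∞)) (X 0) * (‖Ψ.ψ X‖₊ : ℝ≥0∞) ^ 2 with hJ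
  -- the facts
  have hm : mχ + mη = 1 := mass_localize_add hχ.continuous hχη Ψ
  have hE : Eχ + Eη = energy v Ψ + IMS := energy_localize_add hv hχ hη hχη Ψ
  have hfl : E₁ * mη ≤ Eη := hfloor ψη (contDiff_localize hη Ψ.contDiff) fun X hX => by
    simp [hψη, Ψ.eq_zero X hX]
  have hgr : E₀' * mχ ≤ Rest := groundStateEnergy_mul_mass_localize_le hv hχ Ψ
  have hsplit : Eχ = Sh + Rest := by
    have hmeas : Measurable fun X : Config (n + 1) => partialGradSq 0 ψχ X +
        (∑ j : Fin n, v (dist (X 0) (X j.succ))) * (‖ψχ X‖₊ : ℝ≥0∞) ^ 2 := by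
      refine (measurable_partialGradSq 0 ψχ).add (Measurable.mul ?_
        (measurable_normSq (contDiff_localize hχ Ψ.contDiff).continuous))
      refine Finset.measurable_sum _ fun j _ => hv.comp ?_
      exact (measurable_pi_apply 0).dist (measurable_pi_apply _)
    rw [hSh, hRest, ← lintegral_add_left hmeas]
    refine lintegral_congr fun X => ?_
    rw [kineticDensity_eq_partialGradSq_add_kineticOn, interaction_eq_cross_add_interactionOn]
    ring
  -- the chain
  have hchain : E₁ + Sh ≤ E₁ + (δ + IMS + κ * mχ) :=
    calc E₁ + Sh = E₁ * (mχ + mη) + Sh := by rw [hm, mul_one]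
      _ = E₁ * mχ + E₁ * mη + Sh := by rw [mul_add]
      _ ≤ (E₀' + κ) * mχ + Eη + Sh := by gcongr
      _ = E₀' * mχ + Sh + κ * mχ + Eη := by ring
      _ ≤ Rest + Sh + κ * mχ + Eη := by gcongr
      _ = Eχ + Eη + κ * mχ := by rw [hsplit]; ring
      _ = energy v Ψ + IMS + κ * mχ := by rw [hE]
      _ ≤ (E₁ + δ) + IMS + κ * mχ := by gcongr
      _ = E₁ + (δ + IMS + κ * mχ) := by ring
  have hSh_le : Sh ≤ δ + IMS + κ * mχ := (ENNReal.add_le_add_iff_left hEtop).1 hchain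
  -- the three comparisons with one-body quantities
  have hLHS : ∫⁻ X, T.indicator (fun _ => (1 : ℝ≥0∞)) (X 0) *
      (partialGradSq 0 Ψ.ψ X + (∑ j : Fin n, v (dist (X 0) (X j.succ))) * (‖Ψ.ψ X‖₊ : ℝ≥0∞) ^ 2) ≤ Sh :=
    lintegral_mono fun X => indicator_share_le hdχ hχη hT Ψ X
  have hIMS_le : IMS ≤ ENNReal.ofReal (3 * G) * J := by
    rw [hJ, ← lintegral_const_mul' _ _ ENNReal.ofReal_ne_top]
    exact lintegral_mono fun X => ims_le hG (fun x hx => (hB x hx).2) Ψ.ψ X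
  have hm_le : mχ ≤ J := lintegral_mono fun X => mass_localize_le_indicator hχη (fun x hx => (hB x hx).1) Ψ.ψ X
  calc _ ≤ Sh := hLHS
    _ ≤ δ + IMS + κ * mχ := hSh_le
    _ ≤ δ + ENNReal.ofReal (3 * G) * J + κ * J := by gcongr
    _ = δ + (κ + ENNReal.ofReal (3 * G)) * J := by ring

end DenseCell

/-- **Registered helper stub `stub_localEnergyBound`** (lead, for `stub_denseCellBound`): the one-particle local
energy bound `∫ 1_T(x₀)(|∇₀Ψ|² + Σ_{j≥1} v(|x₀−x_j|)|Ψ|²) ≤ δ + (κ + 3G) ∫ 1_B(x₀)|Ψ|²` for a `δ`-near-minimiser, given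
the Dirichlet floor for `(n+1, L)` and the insertion bound `E₀(n+1,L) ≤ E₀(n,L) + κ`. [folklore] -/
theorem stub_localEnergyBound :
    ∀ (n : ℕ) (L : ℝ) (v : ℝ → ENNReal), Measurable v →
      (∀ f : Literature.MathematicalPhysics.QuantumManyBody.BoseGas.Config (n + 1) → ℂ, ContDiff ℝ 1 f →
        (∀ X, X ∉ Literature.MathematicalPhysics.QuantumManyBody.BoseGas.boxN (n + 1) L → f X = 0) →
        Literature.MathematicalPhysics.QuantumManyBody.BoseGas.groundStateEnergy v (n + 1) L *
            ∫⁻ X, (‖f X‖₊ : ENNReal) ^ 2 ≤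
          ∫⁻ X, (Literature.MathematicalPhysics.QuantumManyBody.BoseGas.kineticDensity f X +
            Literature.MathematicalPhysics.QuantumManyBody.BoseGas.interaction v X * (‖f X‖₊ : ENNReal) ^ 2)) →
      ∀ (χ η : EuclideanSpace ℝ (Fin 3) → ℝ), ContDiff ℝ 1 χ → ContDiff ℝ 1 η → (∀ x, χ x ^ 2 + η x ^ 2 = 1) →
      ∀ (G : ℝ), (∀ x, ‖fderiv ℝ χ x‖ ^ 2 + ‖fderiv ℝ η x‖ ^ 2 ≤ G) →
      ∀ (B : Set (EuclideanSpace ℝ (Fin 3))), (∀ x, x ∉ B → χ x = 0 ∧ fderiv ℝ χ x = 0 ∧ fderiv ℝ η x = 0) →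
      ∀ (T : Set (EuclideanSpace ℝ (Fin 3))), (∀ x ∈ T, χ x = 1) →
      ∀ (κ δ : ENNReal),
        Literature.MathematicalPhysics.QuantumManyBody.BoseGas.groundStateEnergy v (n + 1) L ≠ ⊤ →
        Literature.MathematicalPhysics.QuantumManyBody.BoseGas.groundStateEnergy v (n + 1) L ≤
          Literature.MathematicalPhysics.QuantumManyBody.BoseGas.groundStateEnergy v n L + κ →
        ∀ Ψ : Literature.MathematicalPhysics.QuantumManyBody.BoseGas.TrialState (n + 1) L,
          Literature.MathematicalPhysics.QuantumManyBody.BoseGas.energy v Ψ ≤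
            Literature.MathematicalPhysics.QuantumManyBody.BoseGas.groundStateEnergy v (n + 1) L + δ →
          ∫⁻ X, T.indicator (fun _ => (1 : ENNReal)) (X 0) *
              (Literature.MathematicalPhysics.QuantumManyBody.BoseGas.partialGradSq 0 Ψ.ψ X +
                (∑ j : Fin n, v (dist (X 0) (X j.succ))) * (‖Ψ.ψ X‖₊ : ENNReal) ^ 2) ≤
            δ + (κ + ENNReal.ofReal (3 * G)) *
              ∫⁻ X, B.indicator (fun _ => (1 : ENNReal)) (X 0) * (‖Ψ.ψ X‖₊ : ENNReal) ^ 2 :=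
  fun _ _ _ hv hfloor _ _ hχ hη hχη _ hG _ hB _ hT _ _ hEtop hins Ψ hΨ =>
    DenseCell.local_energy_bound hv hfloor hχ hη hχη hG hB hT hEtop hins Ψ hΨ

end Summit.AtomisticToContinuum.BoseEinsteinCondensation.Cruxes.OneBodyEntropyBound.Birth

end
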